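import Summits.QuantumFields.YangMills.Theorems.BalabanUVNodesN22W1RelCentredTermDatum214WindowDilated
import Summits.QuantumFields.YangMills.Theorems.BalabanUVNodesN22W1RelCentredMembersOfDatumBound
import Summits.QuantumFields.YangMills.Theorems.BalabanUVNodesN22W1RelCentredMembersOfDatumTails
import Summits.QuantumFields.YangMills.Theorems.BalabanUVNodesN22W1RelCentredMembersOfDatumCentred
import Summits.QuantumFields.YangMills.Theorems.BalabanUVNodesN22W1RelCentredCentreOfDatum
import Summits.QuantumFields.YangMills.Theorems.BalabanUVNodesN22W1RelCentredSliceInputs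
import Literature.MathematicalPhysics.QuantumFieldTheory.Balaban1983to89.Node00.HistoryTermDatum214WindowDilated

/-!
# BalabanUVNodes ∕ node N22 = NE9 — THE W1 OBJECT ON THE RELATIVE-DISC CENTRED ROAD (RE-TYPING M1′), MODULE J9: THE KNIT AT THE DATUM — `N22At` at the admissible reading of record on
# the run towers generated by the (2.14) term datum FROM LOCATED INPUTS: J2's θ-free engine with every member hypothesis discharged by J5–J8 under the unscaled-field law

Cell `pub-ymgap`, HUMAN RULING D-0062 (Track A), R134 ACCELERATION re-seat `pub-ymgap-dag-n22-c` (strategy s1), generation 7, file J9.  THEOREMS ONLY; imports J2, J6, J7a, J7b, J8 (hence J5)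
BY NAME.  `--supports` K3⁶ `SpineGivenEndpointR13SepCoPR` (stmt-QuantumFields-20509) as a helper.

WHY.  The s1 row of node N22 («the history-Lipschitz estimate on the W1 object») is carried, in the tree, by the re-typed leaf (R2 → J2): `N22At` at the reading of record follows from node N18
below + numerals + SIX member statements about a window-dilated member family of the complex last coupling and a coupling-blind centre.  J5–J8 read each of the six AT THE (2.14) DATUM from
LOCATED primitive inputs (dag-n10-c's B13 engines kernel-keyed).  THIS FILE composes them: ONE theorem whose analytic hypotheses are only (a) the unscaled-field law of the datum's last-line
data on the real window and (b) per slice an ∃-tuple of located inputs — letters and displayed facts about NODE A's kernels, the boxes, the Wilson remainder and the older terms — with the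
member family and the centre no longer hypotheses but the explicit objects of J5 ∕ J7a.  It is the end of the s1 line at node N22 proper: what remains displayed belongs to NODE A ∕ N09 ∕ N10 ∕
def-W1 (the letters' inhabitants at the datum of record: n10-c module 45 `B13ClippedFieldLetters` supplies the 𝒲∕𝒪-letters generically for the clipped unscaled field) and to N18 ∕ K0.

WHAT.  ★ `n22At_u3OfRecord₁₂_ofRecordAdm_runTowers_toClusterTower_of_n18Below_unscaledLawDatum` — statement GENERATED (`gen/build_j9.py`) as the union of J6 ∕ J7a ∕ J7b ∕ J8's located-input
binders (history-dependent ones universally over (1.18)-bounded histories, dilation-dependent ones over the ball, curve-dependent ones as a holomorphy law of `𝒪` along bounded holomorphic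
histories), proof = J2 at `mF := m`, `V := if … then centre else 0` with the six bullets `memberOfDatum_basePoint` ∕ `memberOfDatum_one_eq_TF` ∕ J6 §1 ∕ J6 §2 ∕ `propV_byCases` + J8 ∕
`vertexLetter_byCases` + `vertexLetter_of_threePieces` (J7b, J7a §1, J7a §2, rate) + `vertexLetter_of_largeField` (J7a §3, rate).

HONEST FRAMING.  Count-neutral composition BY NAME; NOT a discharge of N22 (the located inputs, the law, node N18 below, the numerals' inhabitant at the record's letters and K0 are
HYPOTHESES ∕ other lanes'); (S-vertex-T′) NOT PRINTED; nothing of Bałaban's asserted; one finite four-torus programme at fixed ε — NOT infinite volume, NOT OS on ℝ⁴, NOT a mass gap, NOT Clay.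
0 `sorry`, 0 `def`, standard axioms.

References (TYPES only): [I] = [Balaban1987RG1] §1 p. 263, (2.9)–(2.13) pp. 266–268; [II] = [Balaban1988RG2Cluster] (1.41) p. 11, (2.9)–(2.26) pp. 14–17, Lemma 3 p. 20, (2.39)–(2.41) p. 21.
-/

noncomputable section

open scoped Matrix.Norms.L2Operator

namespace YMDAG.N22.W1

open Set Metric Matrix
open scoped BigOperators
open Literature.MathematicalPhysics.QuantumFieldTheory.Balaban1983to89
open Literature.MathematicalPhysics.QuantumFieldTheory.Balaban1983to89.T4Continuum
open Literature.MathematicalPhysics.QuantumFieldTheory.Balaban1983to89.T4OutputRate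
open Literature.MathematicalPhysics.QuantumFieldTheory.Balaban1983to89.TreeLengthTorus (TPt TDom tsys torusTreeLen torusTreeLen_nonneg)
open Literature.MathematicalPhysics.QuantumFieldTheory.Balaban1983to89.B12TreeDecay (K₀ K₀_pos)
open Literature.MathematicalPhysics.QuantumFieldTheory.Balaban1983to89.B13Lemma3TorusData (TBond)
open Literature.MathematicalPhysics.QuantumFieldTheory.Balaban1983to89.B13Lemma3TorusTerms (terms weight weight_nonneg)
open Literature.MathematicalPhysics.QuantumFieldTheory.Balaban1983to89.B13Lemma3TorusSocket (Lemma3Numerics)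
open Literature.MathematicalPhysics.QuantumFieldTheory.Balaban1983to89.B13Term214 (term214 core214 F214)
open Literature.MathematicalPhysics.QuantumFieldTheory.Balaban1983to89.B13Bound143 (invTau)
open Literature.MathematicalPhysics.QuantumFieldTheory.Balaban1983to89.B9Thm37GlueTorus (tdist1)
open Literature.MathematicalPhysics.QuantumFieldTheory.Balaban1983to89.B5TorusCover (UT)
open Literature.MathematicalPhysics.QuantumFieldTheory.Balaban1983to89.Step (SFConsts)
open Literature.MathematicalPhysics.QuantumFieldTheory.Balaban1983to89.Node00
  (Stage12Params Stage13Params U3Objects₁₁ U3Letters₁₁ NE2Objects₁₁ NE3Letters₁₁ MatA ιSU prependCoupling)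
open Literature.MathematicalPhysics.QuantumFieldTheory.Balaban1983to89.Node00.Sect2 (domSys domCount CPair ofBackgroundC spaceI domSites Setting Residual)
open Literature.MathematicalPhysics.QuantumFieldTheory.Balaban1983to89.Node00.W1
open YMDAG.UVSplit

variable {N : ℕ} [NeZero N]

/-! ## §1 The knit at the θ-free engine -/

section Engine

variable {F : T4Family} {M : ℕ} [NeZero M] {L : ℕ} [NeZero L] (Gn : (k₁ : ℕ) → GenTower (F.P k₁) (MatA N) M)
  (sp : (k j : ℕ) → (domSys (F.P k) M j).Dom → Set (CPair (F.P k) (MatA N)))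
  (gauge : (k : ℕ) → GaugeField (F.P k) 0 (Node00.SU N) → GaugeField (F.P k) 0 (Node00.SU N) → ℝ) (hg : ∀ k U U', 0 ≤ gauge k U U')
  (T₀ : (k : ℕ) → GaugeField (F.P (k + 1)) 0 (Node00.SU N) → GaugeField (F.P k) 0 (Node00.SU N))
  (hT₀ : ∀ (k : ℕ) (U : GaugeField (F.P (k + 1)) 0 (Node00.SU N)),
    (∀ (j : ℕ) (Y : (domSys (F.P (k + 1)) M j).Dom), ofBackgroundC (ιSU N) U ∈ sp (k + 1) j Y) →
    ∀ (j : ℕ) (Y : (domSys (F.P k) M j).Dom), ofBackgroundC (ιSU N) (T₀ k U) ∈ sp k j Y)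
  (li : LetterInputs) (θ : Stage12Params F N) (k : ℕ) (c : B13.Consts) (𝔇 : TermData214 c (F.P k) (MatA N) M L)
  (χu χcu : (k' : ℕ) → (Z : (domSys (F.P k) M (k' + 1)).Dom) → (t : TermLabel (F.P k) M k' L) → (((𝔇 k').𝒦 Z t).Λ → ℝ) → ℝ)
  (𝒲 : (k' : ℕ) → (Z : (domSys (F.P k) M (k' + 1)).Dom) → (t : TermLabel (F.P k) M k' L) → CPair (F.P k) (MatA N) →
    TDom (F.P k).d (L * domCount (F.P k) M (k' + 1)) → (((𝔇 k').𝒦 Z t).Λ → ℝ) → ℂ)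
  (𝒪 : (k' : ℕ) → (Z : (domSys (F.P k) M (k' + 1)).Dom) → (t : TermLabel (F.P k) M k' L) → OlderTerms (F.P k) (MatA N) M k' → CPair (F.P k) (MatA N) →
    TDom (F.P k).d (L * domCount (F.P k) M (k' + 1)) → (((𝔇 k').𝒦 Z t).Λ → ℝ) → ℂ)
  {G : Type*} [GaugeGroup G] (Sg : Setting (MatA N) G) (Rz : Residual (F.P k) (MatA N))


open Classical in
/-- **`N22At` AT THE ADMISSIBLE READING OF RECORD ON THE RUN TOWERS GENERATED BY THE (2.14) DATUM, FROM LOCATED INPUTS UNDER THE UNSCALED-FIELD LAW** — J2's θ-free engine with its six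
member hypotheses DISCHARGED: hMbase (J5, law-free), hMagree (J5 under the law), hMlast (J6 §1), hMprop (J6 §2), (P) (J8) and hMcen (J7b + J7a §1 + J7a §2 + J7a §3 through J7a §4) at the
member family of the datum `m(s₀,b)` and the centre `V := if P(t) = ∅ then term(A,Γ,F214 |P| 1 1 𝐃 (Y ↦ 𝒪(old,φ,Y,0))) else 0`.  Displayed: J2's socket data (tables, numerals at `a₅′`, slack,
S25, renewal, apertures `0 < cA < cP < 1`, `cP∕(1−cP) < ρb < 1`, `Mv`, `(1−cP)⁻²Mv((1+cA)γ)² ≤ ½`, `2(1−cP)⁻²Mv·E₀(1+cA)² ≤ li.A`); the UNSCALED-FIELD LAW of the datum on the window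
(`χ_s(B′) = χᵘ(sB′)`, `𝒱_s = s⁻²𝒲(φ,·,s·) + 𝒪(old,φ,·,s·)`, [I] (2.9)–(2.12)); and, PER SLICE `(k′ < k, φ in the table, Z ⊆ X, t ∈ terms L M Z, s₀ ∈ ]0,γ])`, ONE ∃-tuple of LOCATED
INPUTS — the σ∕τ-regions and Cauchy radius, the boxes `χᵘ(s₀·), χᶜᵘ(s₀·)` (signs, measurability, evenness, (2.22) at radius `r_P`, `χχᶜ ≤ 1`, the BOX LAW on `⟨B′,B′⟩ < R²`), NODE A's
kernel letters at the configuration (holomorphy, symmetry, `Re A ≻ 0`, (L17a)∕(L16a), `K_E`, fibre bound), the primed letters of the ball `ρb`, the capstone numerics at the five rates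
(uncentred `γ₂ + a′`, centred `γ₂ + a_c`, box tail `κ + a₀`, box-free `α₀`, centre `γ₂ + a₀`), the weight matching `a ≤ γ₂r_P²`, `a ≤ γ₂r₁²`, the Lemma-2-type letters of the history-free
Wilson remainder `𝒲` and of the older terms `𝒪` for EVERY (1.18)-bounded history (measurability, joint (2.20), the member's (2.20) with primed letters, the background value's bounds,
holomorphy along bounded holomorphic histories, the exponential-moment Taylor letters with an odd first-order part `𝒱₁`) and the RATES `e^{−½κR²} ≤ T·s₀²`, `e^{−½γ₂(r_P²−r₁²)} ≤ T_P·s₀²`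
with `1 + T ≤ Mv`, `T_P ≤ Mv`; node N18 below `k`; the letter signs.  Conclusion: `N22At (u3OfRecord₁₂ θ (Dr.u3Objects θ.γ) k)`.
[cite: Balaban1988RG2Cluster, (1.41) p.11, (2.9)-(2.15) pp.14-16, (2.16)-(2.26) pp.16-17, Lemma 3 p.20 and (2.39)-(2.41) p.21; Balaban1987RG1, §1 p.263, (2.9)-(2.13) pp.266-268] -/
theorem n22At_u3OfRecord₁₂_ofRecordAdm_runTowers_toClusterTower_of_n18Below_unscaledLawDatum {cs : SFConsts} (hGn : Gn k = 𝔇.Gn)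
    (hspk : ∀ (j : ℕ) (Y : (domSys (F.P k) M j).Dom), sp k j Y ⊆ spaceI Sg Rz M j (domSites (F.P k) M j Y) cs.α₀ cs.α₁)
    (hL : 8 ≤ c.L) (hLc : c.L = L) {a a₂ a₂' a₅ a₅' Aabs : ℝ} (hN : Lemma3Numerics c M ((c.L : ℝ) / 2) a a₂ a₂' a₅' Aabs)
    {E₀ r₁ Mv cA cP ρb : ℝ} (hA0 : 0 ≤ c.C3act * c.ε₁) (hr₁ : 0 ≤ r₁) (hκ : li.κ ≤ r₁)
    (hrate : r₁ + 2 * (64 * Real.log 162) + 2 ≤ (1 - 8 * c.δ) * ((c.L : ℝ) / 2) * c.κ)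
    (hsmall : c.C3act * c.ε₁ * Real.exp (5 * r₁ + 1) * K₀ 64 8 * 9 * 64 ≤ 1)
    (hrenew : Real.exp 1 * 9 * 64 * K₀ 64 8 ^ 2 * (c.C3act * c.ε₁) ≤ E₀)
    (h2w : ∀ (k' : ℕ) (Z : (domSys (F.P k) M (k' + 1)).Dom), 2 * Real.exp (a₅ * ((Z.1).card : ℝ)) ≤ Real.exp (a₅' * ((Z.1).card : ℝ)))
    -- apertures: displayed discs `cA` < producer's sector `cP` < 1, producer's ball radius `ρb`
    (hc0 : 0 < cA) (hcAP : cA < cP) (hcP1 : cP < 1) (hρb : cP / (1 - cP) < ρb)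
    (hMv : 0 < Mv) (hMvγ : (1 - cP)⁻¹ ^ 2 * Mv * ((1 + cA) * θ.γ) ^ 2 ≤ 1 / 2) (hAM : 2 * ((1 - cP)⁻¹ ^ 2 * Mv) * E₀ * (1 + cA) ^ 2 ≤ li.A)
    -- THE UNSCALED-FIELD LAW of the datum's last-line data on the real window ([I] (2.9)–(2.12)) — node00-def-W1's W1-11 `TermData214.UnscaledFieldLawOn` BY NAME
    (hlaw : 𝔇.UnscaledFieldLawOn χu χcu 𝒲 𝒪 θ.γ)
    (hκ₁ : 1 ≤ c.κ₁) (hα₆ : c.α₆ ≠ 0) (hρb1 : ρb < 1)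
    -- THE LOCATED INPUTS, one record per slice (k′ < k, φ in the table, Z ⊆ X, t ∈ terms, s₀ ∈ window)
    (ι : ∀ k' : ℕ, k' < k → ∀ (X : (domSys (F.P k) M (k' + 1)).Dom) (φ : CPair (F.P k) (MatA N)),
      φ ∈ spaceI Sg Rz M (k' + 1) (domSites (F.P k) M (k' + 1) X) cs.α₀ cs.α₁ → ∀ (Z : (domSys (F.P k) M (k' + 1)).Dom), Z.1 ⊆ X.1 → ∀ t ∈ terms L M Z, ∀ s₀ ∈ Ioc (0 : ℝ) θ.γ,
      SliceInputs (𝔇 k') (χu k') (χcu k') (𝒲 k') (𝒪 k') c Sg Rz cs E₀ li.κ Z t φ s₀ a a₅ ρb Mv)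
    (h18 : ∀ k' : ℕ, k' < k →
      N18At (u3OfRecord₁₂ θ ((ReadingData.ofRecordAdm F M N (runTowers fun k₁ => toClusterTower (Gn k₁)) sp gauge hg T₀ hT₀ li).u3Objects θ.γ) k'))
    (hC5 : 0 ≤ li.C₅) (hθ1 : li.θ₅ < 1) (hC₀' : 2 * li.C₅ / (1 - li.θ₅) ≤ li.C₀)
    (hC₀ : 0 < li.C₀) (hθ5 : 0 < li.θ₅) (hA : 0 < li.A) (hμ : li.μ = 1) (hr : 0 < li.r) (hrc : li.r ≤ min cA 1) (hγ : 0 < θ.γ) (hs : li.s = (2 : ℝ)⁻¹) :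
    N22At (u3OfRecord₁₂ θ ((ReadingData.ofRecordAdm F M N (runTowers fun k₁ => toClusterTower (Gn k₁)) sp gauge hg T₀ hT₀ li).u3Objects θ.γ) k) := by
  -- positivity of the (2.26) weight (for the `else 0` branches)
  have hA6 : 0 ≤ c.α₆ * c.eps2 := mul_nonneg hN.hα₆.le hN.hε₀
  have hWnn : ∀ (k' : ℕ) (Z : (domSys (F.P k) M (k' + 1)).Dom) (t : TermLabel (F.P k) M k' L),
      0 ≤ weight L M c Z a t * Real.exp (a₅ * ((Z.1).card : ℝ)) := fun k' Z t => mul_nonneg (weight_nonneg c Z a hA6 t) (Real.exp_pos _).le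
  have hγw : θ.γ ∈ Ioc (0 : ℝ) θ.γ := ⟨hγ, le_rfl⟩
  refine n22At_u3OfRecord₁₂_ofRecordAdm_runTowers_toClusterTower_of_n18Below_windowDilatedTermDatum Gn sp gauge hg T₀ hT₀ li θ k c 𝔇
    (fun s₀ k' Z t b old φ => term214 (𝔇 k').r (sigmaList L Z t) (tauList (F.P k) M k' L t)
          (core214 (fun σ => b ^ 2 • (𝔇 k').A Z t φ σ) (fun σ X => b • (𝔇 k').Gam Z t φ σ X)
            (F214 t.2.card (fun B => χu k' Z t (s₀ • B)) (fun B => χcu k' Z t (s₀ • B)) t.1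
              (fun Y B => b ^ 2 * ((((s₀ : ℝ) : ℂ) ^ 2)⁻¹ * 𝒲 k' Z t φ Y (s₀ • B)) + 𝒪 k' Z t old φ Y (s₀ • B)))) 0 0)
    (fun k' Z t old φ => if t.2 = ∅ then term214 (𝔇 k').r (sigmaList L Z t) (tauList (F.P k) M k' L t)
            (core214 ((𝔇 k').A Z t φ) ((𝔇 k').Gam Z t φ) (F214 t.2.card (fun _ => (1 : ℝ)) (fun _ => (1 : ℝ)) t.1 (fun Y _ => 𝒪 k' Z t old φ Y 0))) 0 0 else 0)
    Sg Rz hGn hspk hL hLc hN hA0 hr₁ hκ hrate hsmall hrenew h2w hc0 hcAP hcP1 hρb hMv hMvγ hAM ?_ ?_ ?_ ?_ ?_ ?_ h18 hC5 hθ1 hC₀' hC₀ hθ5 hA hμ hr hrc hγ hs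
  · -- hMbase: J5, law-free
    intro k' Z t old φ s₀ hs₀ s₁ hs₁ b
    exact memberOfDatum_basePoint 𝔇 χu χcu 𝒲 𝒪 k' Z t old φ s₀ hs₀ s₁ hs₁ b
  · -- hMagree: J5 under the unscaled-field law
    intro k' Z t s hs' old φ
    exact memberOfDatum_one_eq_TF 𝔇 χu χcu 𝒲 𝒪 ((TermData214.unscaledFieldLawOn_iff 𝔇 χu χcu 𝒲 𝒪 θ.γ).1 hlaw) k' Z t s hs' old φ
  · -- hMlast: J6 §1 at the slice
    intro k' hk old hold X φ hφ Z hZ t ht s₀ hs₀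
    have I := ι k' hk X φ hφ Z hZ t ht s₀ hs₀
    exact differentiableOn_and_norm_memberOfDatum_le_weight_of_primitives (𝔇 k') (χu k') (χcu k') (𝒲 k') (𝒪 k') c hκ₁ hα₆ Z t old φ s₀ I.hpos I.hhalf I.hUσ I.hUτ I.hUexp I.hUtau I.hr I.hr' I.hsubτ I.hχ0 I.hχc0 I.hχm I.hχcm I.qP I.h222 I.hγ₂ I.hqP I.ha0 I.hWm (I.hOm_all old) (I.h220U_all old hold) I.hAhol I.hGhol I.hAs I.hfibN I.hkap'' I.h1 I.h2 I.hθE I.hθΓ I.hθC I.hKG I.hKΓ I.hKCs I.hK₀ I.hKE I.hG I.hΓ₀ I.hCs I.hC216 I.hCE I.hdΓ I.hdC I.hdE hρb1 I.hKG' I.hKCs' I.hθΓ' I.hθC' I.hθE' I.ha' I.hw' I.hθEle I.hθΓle I.hθR1le I.hsmallKθ I.hc0 I.hc I.hαc I.hg I.hΓq I.hsmall (a := a) (a₅ := a₅) I.hPa I.hvol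
  · -- hMprop: J6 §2 at the slice, along the curve
    intro k' hk i hi O hO s₀ hs₀ b hb cv hcv X φ hφ Z hZ t ht
    have I := ι k' hk X φ hφ Z hZ t ht s₀ hs₀
    exact differentiableOn_and_norm_memberOfDatum_history_of_primitives (𝔇 k') (χu k') (χcu k') (𝒲 k') (𝒪 k') c hκ₁ hα₆ Z t φ s₀ hO cv I.hpos I.hhalf I.hUσ I.hUτ I.hUexp I.hUtau I.hr I.hr' I.hsubτ I.hχ0 I.hχc0 I.hχm I.hχcm I.qP I.h222 I.hγ₂ I.hqP I.ha0 I.hWm (fun z _ => I.hOm_all (cv z)) (fun Y B => I.hOhol O hO cv hcv Y (s₀ • B)) (fun z hz => I.h220U_all (cv z) (fun j Y ψ hψ => (hcv j Y ψ hψ).2 z hz)) I.hAhol I.hGhol I.hAs I.hfibN I.hkap'' I.h1 I.h2 I.hθE I.hθΓ I.hθC I.hKG I.hKΓ I.hKCs I.hK₀ I.hKE I.hG I.hΓ₀ I.hCs I.hC216 I.hCE I.hdΓ I.hdC I.hdE hρb1 I.hKG' I.hKCs' I.hθΓ' I.hθC' I.hθE' I.ha' I.hw' I.hθEle I.hθΓle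 I.hθR1le I.hsmallKθ I.hc0 I.hc I.hαc I.hg I.hΓq I.hsmall (a := a) (a₅ := a₅) I.hPa I.hvol hb
  · -- (P) for the centre: J8 at the slice of base point γ, by cases on the large-field set
    intro k' hk O hO cv hcv X φ hφ Z hZ t ht
    have I := ι k' hk X φ hφ Z hZ t ht θ.γ hγw
    refine propV_byCases (hWnn k' Z t) fun hP => ?_
    have hP0 : t.2.card = 0 := by rw [hP, Finset.card_empty]
    exact differentiableOn_and_norm_centreOfDatum_of_primitives (𝔇 k') (𝒪 k') Z t φ hP0 hO cv (fun Y => I.hOhol O hO cv hcv Y 0) c hκ₁ hα₆ I.hpos I.hhalf I.hUσ I.hUτ I.hUexp I.hUtau I.hr I.hr' I.hsubτ I.hAhol I.hAs I.hA I.hGhol (a₂₀ := I.a₀) (w := I.w₀) I.hγ₂ I.ha₀ I.hfibN I.hkap'' I.h1 I.h2 I.hθE I.hθΓ I.hθC I.hKG I.hKΓ I.hKCs I.hK₀ I.hθEle0 I.hθΓle0 I.hθR1le0 I.hG I.hΓ₀ I.hCs I.hC216 I.hdΓ I.hdC I.hdE I.hsmallKθ I.hc0 I.hc I.hαc_0 I.hg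 I.hΓq I.hsmall_0 (a := a) (a₅ := a₅) I.hPa I.hvol_0 (fun z hz => I.h220V0_all (cv z) (fun j Y ψ hψ => (hcv j Y ψ hψ).2 z hz))
  · -- hMcen: the three pieces (J7b, J7a §1, J7a §2) for P(t) = ∅, the large-field surplus (J7a §3) otherwise
    intro k' hk old hold X φ hφ Z hZ t ht s₀ hs₀ b hb
    have I := ι k' hk X φ hφ Z hZ t ht s₀ hs₀
    refine vertexLetter_byCases (hWnn k' Z t) (fun hP => ?_) (fun hP => ?_) I.hMvT I.hMvP
    · have hP0 : t.2.card = 0 := by rw [hP, Finset.card_empty]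
      exact vertexLetter_of_threePieces (hWnn k' Z t)
        (norm_memberOfDatum_sub_boxedCentre_le_of_primitives (𝔇 k') (χu k') (χcu k') (𝒲 k') (𝒪 k') Z t old φ s₀ b (I.𝒱₁ old b) c hκ₁ hα₆ I.hpos I.hhalf I.hUσ I.hUτ I.hUexp I.hUtau I.hr I.hr' I.hsubτ I.hχ0 I.hχc0 I.hχe I.hχce I.hAhol I.hχm I.hχcm (fun Y => (((I.hWm Y).const_mul _).const_mul _).add (I.hOm_all old Y)) (fun Y => measurable_const) (I.hV₁m_all old b) (I.hV₁o_all old b) I.hAs I.hGhol (a₂₀ := I.a') (w := I.w') I.qP I.h222 I.hγ₂ I.hqP (le_trans (mul_nonneg (sq_nonneg _) I.ha0) I.ha') (I.h220Ub_all old hold b hb) (fun τ hτ _B => I.hw₀U_all old hold τ hτ) hs₀.1.le I.hK₁ I.hK₂ I.ha₁ (I.h1eU_all old hold b hb) (I.h2eU_all old hold b hb) I.hac₀ I.hac₂ I.hac₁ I.hwc I.hfibN I.hkap'' I.h1 I.h2 I.hθE I.hθΓ I.hθC I.hKG I.hKΓ I.hKCs I.hK₀ I.hKE I.hG I.hΓ₀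 I.hCs I.hC216 I.hCE I.hdΓ I.hdC I.hdE hρb1 I.hKG' I.hKCs' I.hθΓ' I.hθC' I.hθE' I.hθEle I.hθΓle I.hθR1le I.hsmallKθ I.hc0 I.hc I.hαc_c I.hg I.hΓq I.hsmall_c (a := a) (a₅ := a₅) I.hPa I.hvol_c hb)
        (norm_boxTail_memberOfDatum_le_of_primitives (𝔇 k') (χu k') (χcu k') (𝒪 k') Z t old φ s₀ c hκ₁ hα₆ I.hpos I.hhalf I.hUσ I.hUτ I.hUexp I.hUtau I.hr I.hr' I.hsubτ I.hχ0 I.hχc0 I.hχ1 I.hκ I.hbox I.hAhol I.hχm I.hχcm (fun Y => measurable_const) I.hAs I.hGhol hP0 I.ha₀ (I.h220V0_all old hold) I.hfibN I.hkap'' I.h1 I.h2 I.hθE I.hθΓ I.hθC I.hKG I.hKΓ I.hKCs I.hK₀ I.hKE I.hG I.hΓ₀ I.hCs I.hC216 I.hCE I.hdΓ I.hdC I.hdE hρb1 I.hKG' I.hKCs' I.hθΓ' I.hθC' I.hθE' I.hθEle I.hθΓle I.hθR1le I.hsmallKθ I.hc0 I.hc I.hαc_b I.hg I.hΓq I.hsmall_b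 (a := a) (a₅ := a₅) I.hvol_b hb)
        (boxFreeCentre_memberOfDatum_eq_of_primitives (𝔇 k') (𝒪 k') Z t old φ c I.hUσ I.hUτ I.hUexp I.hr I.hr' I.hsubτ I.hAhol I.hAs I.hGhol (I.hw₀U_all old hold) I.hfibN I.hkap'' I.h1 I.h2 I.hθE I.hθΓ I.hθC I.hKG I.hKΓ I.hKCs I.hK₀ I.hKE I.hG I.hΓ₀ I.hCs I.hC216 I.hCE I.hdΓ I.hdC I.hdE hρb1 I.hKG' I.hKCs' I.hθΓ' I.hθC' I.hθE' I.hθEle I.hθΓle I.hθR1le I.hsmallKθ I.hc0 I.hc I.hα₀ I.hαc_f I.hΓq I.hsmall_f b hb) I.hR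
    · have hP1 : 1 ≤ t.2.card := Finset.card_pos.2 (Finset.nonempty_iff_ne_empty.2 hP)
      exact vertexLetter_of_largeField (hWnn k' Z t)
        (norm_memberOfDatum_le_largeField_of_primitives (𝔇 k') (χu k') (χcu k') (𝒲 k') (𝒪 k') Z t old φ s₀ c hκ₁ hα₆ I.hpos I.hhalf I.hUσ I.hUτ I.hUexp I.hUtau I.hr I.hr' I.hsubτ I.hχ0 I.hχc0 I.hAhol I.hχm I.hχcm I.hWm (I.hOm_all old) I.hAs I.hGhol I.qP I.h222 I.hγ₂ I.hqP I.hr₁ hP1 I.ha0 (I.h220U_all old hold) I.hfibN I.hkap'' I.h1 I.h2 I.hθE I.hθΓ I.hθC I.hKG I.hKΓ I.hKCs I.hK₀ I.hKE I.hG I.hΓ₀ I.hCs I.hC216 I.hCE I.hdΓ I.hdC I.hdE hρb1 I.hKG' I.hKCs' I.hθΓ' I.hθC' I.hθE' I.ha' I.hw' I.hθEle I.hθΓle I.hθR1le I.hsmallKθ I.hc0 I.hc I.hαc I.hg I.hΓq I.hsmall (a := a) (a₅ := a₅) I.hPa1 I.hvol hb) I.hTP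

end Engine

/-! ## §2 The engine at one Stage-13 tuple -/

section Engine13

variable {F : T4Family} (θ : Stage13Params F N) {L : ℕ} [NeZero L] (Gn : (k₁ : ℕ) → GenTower (F.P k₁) (MatA N) θ.τ9.M)
  (sp : (k j : ℕ) → (domSys (F.P k) θ.τ9.M j).Dom → Set (CPair (F.P k) (MatA N)))
  (gauge : (k : ℕ) → GaugeField (F.P k) 0 (Node00.SU N) → GaugeField (F.P k) 0 (Node00.SU N) → ℝ) (hg : ∀ k U U', 0 ≤ gauge k U U')
  (T₀ : (k : ℕ) → GaugeField (F.P (k + 1)) 0 (Node00.SU N) → GaugeField (F.P k) 0 (Node00.SU N))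
  (hT₀ : ∀ (k : ℕ) (U : GaugeField (F.P (k + 1)) 0 (Node00.SU N)),
    (∀ (j : ℕ) (Y : (domSys (F.P (k + 1)) θ.τ9.M j).Dom), ofBackgroundC (ιSU N) U ∈ sp (k + 1) j Y) →
    ∀ (j : ℕ) (Y : (domSys (F.P k) θ.τ9.M j).Dom), ofBackgroundC (ιSU N) (T₀ k U) ∈ sp k j Y)
  (li : LetterInputs) (k : ℕ) (c : B13.Consts) (𝔇 : TermData214 c (F.P k) (MatA N) θ.τ9.M L)
  (χu χcu : (k' : ℕ) → (Z : (domSys (F.P k) θ.τ9.M (k' + 1)).Dom) → (t : TermLabel (F.P k) θ.τ9.M k' L) → (((𝔇 k').𝒦 Z t).Λ → ℝ) → ℝ)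
  (𝒲 : (k' : ℕ) → (Z : (domSys (F.P k) θ.τ9.M (k' + 1)).Dom) → (t : TermLabel (F.P k) θ.τ9.M k' L) → CPair (F.P k) (MatA N) →
    TDom (F.P k).d (L * domCount (F.P k) θ.τ9.M (k' + 1)) → (((𝔇 k').𝒦 Z t).Λ → ℝ) → ℂ)
  (𝒪 : (k' : ℕ) → (Z : (domSys (F.P k) θ.τ9.M (k' + 1)).Dom) → (t : TermLabel (F.P k) θ.τ9.M k' L) → OlderTerms (F.P k) (MatA N) θ.τ9.M k' → CPair (F.P k) (MatA N) →
    TDom (F.P k).d (L * domCount (F.P k) θ.τ9.M (k' + 1)) → (((𝔇 k').𝒦 Z t).Λ → ℝ) → ℂ)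
  {G : Type*} [GaugeGroup G] (Sg : Setting (MatA N) G) (Rz : Residual (F.P k) (MatA N))

open Classical in
/-- **§1 AT ONE STAGE-13 TUPLE** (`NeZero θ.τ9.M` from the context; the Stage-13 bundle IS the Stage-12 bundle of `θ.toStage12Params`, `u3OfRecord₁₃_eq_u3OfRecord₁₂`) — the face the
keyed binder storeys (Sep ∕ Co ∕ CoP editions) instantiate once per tuple, exactly as R2b §1 serves R2b §2 ∕ R2c ∕ their Co∕CoP twins.
[cite: Balaban1988RG2Cluster, (2.9)-(2.15) pp.14-16, (2.26) p.17, Lemma 3 p.20 and (2.39)-(2.41) p.21; Balaban1987RG1, §1 p.263, (2.9)-(2.13) pp.266-268] -/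
theorem n22At_u3OfRecord₁₃_ofRecordAdm_runTowers_toClusterTower_of_n18Below_unscaledLawDatum [NeZero θ.τ9.M] {cs : SFConsts} (hGn : Gn k = 𝔇.Gn)
    (hspk : ∀ (j : ℕ) (Y : (domSys (F.P k) θ.τ9.M j).Dom), sp k j Y ⊆ spaceI Sg Rz θ.τ9.M j (domSites (F.P k) θ.τ9.M j Y) cs.α₀ cs.α₁)
    (hL : 8 ≤ c.L) (hLc : c.L = L) {a a₂ a₂' a₅ a₅' Aabs : ℝ} (hN : Lemma3Numerics c θ.τ9.M ((c.L : ℝ) / 2) a a₂ a₂' a₅' Aabs)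
    {E₀ r₁ Mv cA cP ρb : ℝ} (hA0 : 0 ≤ c.C3act * c.ε₁) (hr₁ : 0 ≤ r₁) (hκ : li.κ ≤ r₁)
    (hrate : r₁ + 2 * (64 * Real.log 162) + 2 ≤ (1 - 8 * c.δ) * ((c.L : ℝ) / 2) * c.κ)
    (hsmall : c.C3act * c.ε₁ * Real.exp (5 * r₁ + 1) * K₀ 64 8 * 9 * 64 ≤ 1)
    (hrenew : Real.exp 1 * 9 * 64 * K₀ 64 8 ^ 2 * (c.C3act * c.ε₁) ≤ E₀)
    (h2w : ∀ (k' : ℕ) (Z : (domSys (F.P k) θ.τ9.M (k' + 1)).Dom), 2 * Real.exp (a₅ * ((Z.1).card : ℝ)) ≤ Real.exp (a₅' * ((Z.1).card : ℝ)))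
    -- apertures: displayed discs `cA` < producer's sector `cP` < 1, producer's ball radius `ρb`
    (hc0 : 0 < cA) (hcAP : cA < cP) (hcP1 : cP < 1) (hρb : cP / (1 - cP) < ρb)
    (hMv : 0 < Mv) (hMvγ : (1 - cP)⁻¹ ^ 2 * Mv * ((1 + cA) * θ.γ) ^ 2 ≤ 1 / 2) (hAM : 2 * ((1 - cP)⁻¹ ^ 2 * Mv) * E₀ * (1 + cA) ^ 2 ≤ li.A)
    -- THE UNSCALED-FIELD LAW of the datum's last-line data on the real window ([I] (2.9)–(2.12)) — node00-def-W1's W1-11 `TermData214.UnscaledFieldLawOn` BY NAME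
    (hlaw : 𝔇.UnscaledFieldLawOn χu χcu 𝒲 𝒪 θ.γ)
    (hκ₁ : 1 ≤ c.κ₁) (hα₆ : c.α₆ ≠ 0) (hρb1 : ρb < 1)
    -- THE LOCATED INPUTS, one record per slice (k′ < k, φ in the table, Z ⊆ X, t ∈ terms, s₀ ∈ window)
    (ι : ∀ k' : ℕ, k' < k → ∀ (X : (domSys (F.P k) θ.τ9.M (k' + 1)).Dom) (φ : CPair (F.P k) (MatA N)),
      φ ∈ spaceI Sg Rz θ.τ9.M (k' + 1) (domSites (F.P k) θ.τ9.M (k' + 1) X) cs.α₀ cs.α₁ → ∀ (Z : (domSys (F.P k) θ.τ9.M (k' + 1)).Dom), Z.1 ⊆ X.1 → ∀ t ∈ terms L θ.τ9.M Z, ∀ s₀ ∈ Ioc (0 : ℝ) θ.γ,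
      SliceInputs (𝔇 k') (χu k') (χcu k') (𝒲 k') (𝒪 k') c Sg Rz cs E₀ li.κ Z t φ s₀ a a₅ ρb Mv)
    (h18 : ∀ k' : ℕ, k' < k →
      N18At (u3OfRecord₁₃ θ ((ReadingData.ofRecordAdm F θ.τ9.M N (runTowers fun k₁ => toClusterTower (Gn k₁)) sp gauge hg T₀ hT₀ li).u3Objects θ.γ) k'))
    (hC5 : 0 ≤ li.C₅) (hθ1 : li.θ₅ < 1) (hC₀' : 2 * li.C₅ / (1 - li.θ₅) ≤ li.C₀)
    (hC₀ : 0 < li.C₀) (hθ5 : 0 < li.θ₅) (hA : 0 < li.A) (hμ : li.μ = 1) (hr : 0 < li.r) (hrc : li.r ≤ min cA 1) (hγ : 0 < θ.γ) (hs : li.s = (2 : ℝ)⁻¹) :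
    N22At (u3OfRecord₁₃ θ ((ReadingData.ofRecordAdm F θ.τ9.M N (runTowers fun k₁ => toClusterTower (Gn k₁)) sp gauge hg T₀ hT₀ li).u3Objects θ.γ) k) := by
  rw [u3OfRecord₁₃_eq_u3OfRecord₁₂]
  exact n22At_u3OfRecord₁₂_ofRecordAdm_runTowers_toClusterTower_of_n18Below_unscaledLawDatum Gn sp gauge hg T₀ hT₀ li θ.toStage12Params k c 𝔇 χu χcu 𝒲 𝒪 Sg Rz hGn hspk hL
    hLc hN hA0 hr₁ hκ hrate hsmall hrenew h2w hc0 hcAP hcP1 hρb hMv hMvγ hAM hlaw hκ₁ hα₆ hρb1 ι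
    (fun k' hk => by rw [← u3OfRecord₁₃_eq_u3OfRecord₁₂]; exact h18 k' hk) hC5 hθ1 hC₀' hC₀ hθ5 hA hμ hr hrc hγ hs

end Engine13

end YMDAG.N22.W1

end
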